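import Summits.Parity.GeneralizedHardyLittlewood.Theorems.FordMaynardSieveConst01651SieveConst01651CertTableKeys
import Summits.Parity.GeneralizedHardyLittlewood.Theorems.FordMaynardSieveConst01651SieveConst01651Grid
import Summits.Parity.GeneralizedHardyLittlewood.Theorems.FordMaynardSieveConst01651SieveConst01651TypeData
import HarnessLib

/-!
# Route `FordMaynardSieveConst01651`, target `SieveConst01651` (stmt-Parity-19185), stub `stub_certValuePos` (R2):
# the `g₂` integrand of `S⁰_2` splits along the table entries (pointwise)

Def-free helper file (step (2) of the `certP`/`certN` soundness, see `…CertAssembly`).  For `t ≠ c₀` (and every `u`), the integrand of `S⁰_2(t)` (`…ConeCuts.sliceFnOrd_two` with `gTab 2`,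
`…PairingTwoFaces`) is the finite sum over the table entries `e = (a, b, j, c)` of `c/10⁶ · 𝟙_{P_e}(t, u)/(u(t−u))`, where
`P_e(t,u)` says: `u` in the open cell `a`, `t − u` in the open cell `b`, `u ≤ t − u`, `t` in band `j` (`t < c₀` for
`j = 0`, `c₀ < t` otherwise) and `t < 1/2` (`gTab_two_integrand_eq_sum`).  Ingredients: the cell index of a point of an
open cell (`…Grid`), the band index (`…TypeData.bandIdx_eq_zero_iff`), the lookup as a sum (`…CertTableKeys`), and the
kernel fact that all keys have `a, b ≤ 71`, `j ≤ 1` (`certG2_keys_small`).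

References: [FordMaynard2024PrimeSieves] arXiv:2407.14368, §8.2 (the table of g₂).
-/

noncomputable section

open scoped Classical

namespace Summit.Parity.GeneralizedHardyLittlewood.FordMaynardSieveConst01651SieveConst01651

/-- All table keys are small: `a ≤ 71`, `b ≤ 71`, `j ≤ 1` (kernel evaluation). [folklore] -/
theorem certG2_keys_small :
    (certG2.all fun e => decide (e.1 ≤ 71) && decide (e.2.1 ≤ 71) && decide (e.2.2.1 ≤ 1)) = true := by
  decide +kernel

/-- Entry-wise form of `certG2_keys_small`. [folklore] -/
theorem certG2_key_small {e : ℕ × ℕ × ℕ × ℤ} (he : e ∈ certG2) : e.1 ≤ 71 ∧ e.2.1 ≤ 71 ∧ e.2.2.1 ≤ 1 := by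
  have h := certG2_keys_small
  rw [List.all_eq_true] at h
  have h' := h e he
  simp only [Bool.and_eq_true, decide_eq_true_eq] at h'
  exact ⟨h'.1.1, h'.1.2, h'.2⟩

/-- Every grid edge is at least `ν₀`. [folklore] -/
theorem nu_le_certEdge (a : ℕ) : (1651 / 10000 : ℝ) ≤ ((certEdge a : ℚ) : ℝ) := by
  have h0 : ((certEdge 0 : ℚ) : ℝ) = 1651 / 10000 := by rw [certEdge_cast_of_le (by norm_num)]; norm_num
  rcases Nat.eq_zero_or_pos a with rfl | ha
  · rw [h0]
  · by_cases h85 : a ≤ 85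
    · rw [← h0]; exact (certEdge_cast_lt ha h85).le
    · unfold certEdge
      rw [if_neg (by omega), if_neg (by omega)]
      push_cast; norm_num

/-- A point of the open cell `a ≤ 83` off... (no edge hypothesis needed): its cell index is `a`, it lies in `openSmall`.
[folklore] -/
theorem mem_cell_iff_cellIdx {u : ℝ} (hu : u ∈ openSmall) {a : ℕ} (ha : a ≤ 83) :
    (((certEdge a : ℚ) : ℝ) < u ∧ u < ((certEdge (a + 1) : ℚ) : ℝ)) ↔ cellIdx u = a := by
  constructor
  · rintro ⟨h1, h2⟩; exact cellIdx_eq_of_mem_cell ha h1 h2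
  · rintro rfl
    exact ⟨certEdge_cellIdx_lt hu, (cellIdx_spec hu.1 hu.2.1).2.2⟩

/-- The entry condition `P_e(t,u)` forces the generic hypotheses (`ν₀ < u ≤ t − u`, both coordinates in `openSmall`,
`t < 1/2`) when the key is small. [folklore] -/
theorem entryCond_imp {t u : ℝ} {e : ℕ × ℕ × ℕ × ℤ} (he : e ∈ certG2)
    (h : ((certEdge e.1 : ℚ) : ℝ) < u ∧ u < ((certEdge (e.1 + 1) : ℚ) : ℝ) ∧
      ((certEdge e.2.1 : ℚ) : ℝ) < t - u ∧ t - u < ((certEdge (e.2.1 + 1) : ℚ) : ℝ) ∧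
      u ≤ t - u ∧ (if e.2.2.1 = 0 then t < 8349 / 20000 else 8349 / 20000 < t) ∧ t < 1 / 2) :
    (1651 / 10000 : ℝ) < u ∧ u ≤ t - u ∧ u ∈ openSmall ∧ t - u ∈ openSmall ∧ t < 1 / 2 := by
  obtain ⟨ha, hb, -⟩ := certG2_key_small he
  obtain ⟨h1, h2, h3, h4, h5, -, h7⟩ := h
  exact ⟨lt_of_le_of_lt (nu_le_certEdge _) h1, h5, mem_openSmall_of_mem_cell (by omega) h1 h2,
    mem_openSmall_of_mem_cell (by omega) h3 h4, h7⟩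

/-- Division of a list sum of reals. [folklore] -/
theorem list_sum_map_div {ι : Type*} (l : List ι) (f : ι → ℝ) (d : ℝ) :
    (l.map f).sum / d = (l.map fun i => f i / d).sum := by
  simp only [div_eq_mul_inv, List.sum_map_mul_right]

/-- **The `g₂` integrand as a sum over the table entries.**  For `t ≠ c₀` and every `u`:
`𝟙[ν₀ < u ≤ t−u]·gTab₂(u, t−u)/(u(t−u)) = Σ_{e ∈ certG2} (c_e/10⁶)·𝟙_{P_e}(t,u)/(u(t−u))` (on the grid edges both
sides vanish: the cells are open and `openSmall` excludes the edges).
[cite: FordMaynard2024PrimeSieves, §8.2 (the table of g₂)] -/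
theorem gTab_two_integrand_eq_sum {t u : ℝ} (ht : t ≠ 8349 / 20000) :
    (if (1651 / 10000 : ℝ) < u ∧ u ≤ t - u then gTab 2 ![u, t - u] / (u * (t - u)) else 0) =
      (certG2.map fun e => ((e.2.2.2 : ℤ) : ℝ) / 1000000 *
        (if ((certEdge e.1 : ℚ) : ℝ) < u ∧ u < ((certEdge (e.1 + 1) : ℚ) : ℝ) ∧
            ((certEdge e.2.1 : ℚ) : ℝ) < t - u ∧ t - u < ((certEdge (e.2.1 + 1) : ℚ) : ℝ) ∧
            u ≤ t - u ∧ (if e.2.2.1 = 0 then t < 8349 / 20000 else 8349 / 20000 < t) ∧ t < 1 / 2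
          then 1 / (u * (t - u)) else 0)).sum := by
  -- the table part of the witness at the pair `(u, t − u)`
  have hgTab : gTab 2 ![u, t - u] =
      if u ≤ t - u ∧ u ∈ openSmall ∧ t - u ∈ openSmall ∧ u + (t - u) ≠ 8349 / 20000 ∧ u + (t - u) < 1 / 2 then
        (g2Lookup (cellIdx u) (cellIdx (t - u)) (bandIdx (u + (t - u))) : ℝ) / 1000000 else 0 := rfl
  by_cases hmain : (1651 / 10000 : ℝ) < u ∧ u ≤ t - u ∧ u ∈ openSmall ∧ t - u ∈ openSmall ∧ t < 1 / 2
  · obtain ⟨hν, hle, ho1, ho2, ht2⟩ := hmain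
    rw [if_pos ⟨hν, hle⟩, hgTab, if_pos ⟨hle, ho1, ho2, by rw [add_sub_cancel]; exact ht, by
      rw [add_sub_cancel]; exact ht2⟩, add_sub_cancel, g2Lookup_eq_sum, Int.cast_list_sum, List.map_map,
      list_sum_map_div, list_sum_map_div]
    congr 1
    refine List.map_congr_left fun e he => ?_
    obtain ⟨ha, hb, hj⟩ := certG2_key_small he
    have hc1 := mem_cell_iff_cellIdx ho1 (a := e.1) (by omega)
    have hc2 := mem_cell_iff_cellIdx ho2 (a := e.2.1) (by omega)
    have hband := bandIdx_eq_zero_iff t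
    have hiff : (e.1 = cellIdx u ∧ e.2.1 = cellIdx (t - u) ∧ e.2.2.1 = bandIdx t) ↔
        (((certEdge e.1 : ℚ) : ℝ) < u ∧ u < ((certEdge (e.1 + 1) : ℚ) : ℝ) ∧
          ((certEdge e.2.1 : ℚ) : ℝ) < t - u ∧ t - u < ((certEdge (e.2.1 + 1) : ℚ) : ℝ) ∧
          u ≤ t - u ∧ (if e.2.2.1 = 0 then t < 8349 / 20000 else 8349 / 20000 < t) ∧ t < 1 / 2) := by
      constructor
      · rintro ⟨h1, h2, h3⟩
        refine ⟨(hc1.2 h1.symm).1, (hc1.2 h1.symm).2, (hc2.2 h2.symm).1, (hc2.2 h2.symm).2, hle, ?_, ht2⟩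
        by_cases hj0 : e.2.2.1 = 0
        · rw [if_pos hj0]; exact hband.1.1 (by rw [← h3, hj0])
        · rw [if_neg hj0]
          have hne : bandIdx t ≠ 0 := by rw [← h3]; exact hj0
          have hge : ¬ t < 8349 / 20000 := fun h => hne (hband.1.2 h)
          push Not at hge
          exact lt_of_le_of_ne hge (Ne.symm ht)
      · rintro ⟨h1, h2, h3, h4, -, h6, -⟩
        refine ⟨(hc1.1 ⟨h1, h2⟩).symm, (hc2.1 ⟨h3, h4⟩).symm, ?_⟩
        by_cases hj0 : e.2.2.1 = 0
        · rw [if_pos hj0] at h6; rw [hj0]; exact (hband.1.2 h6).symm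
        · rw [if_neg hj0] at h6
          have hj1 : e.2.2.1 = 1 := by omega
          have hne : bandIdx t ≠ 0 := fun h => by have := hband.1.1 h; linarith
          rw [hj1]; exact (hband.2 hne).symm
    simp only [Function.comp_apply]
    by_cases hk : e.1 = cellIdx u ∧ e.2.1 = cellIdx (t - u) ∧ e.2.2.1 = bandIdx t
    · rw [if_pos hk, if_pos (hiff.1 hk)]; ring
    · rw [if_neg hk, if_neg (fun h => hk (hiff.2 h))]; simp
  · -- both sides vanish
    have hL : (if (1651 / 10000 : ℝ) < u ∧ u ≤ t - u then gTab 2 ![u, t - u] / (u * (t - u)) else 0) = 0 := by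
      split_ifs with h
      · rw [hgTab, if_neg, zero_div]
        rintro ⟨-, ho1, ho2, -, hlt⟩
        rw [add_sub_cancel] at hlt
        exact hmain ⟨h.1, h.2, ho1, ho2, hlt⟩
      · rfl
    rw [hL]
    symm
    apply List.sum_eq_zero
    intro x hx
    rw [List.mem_map] at hx
    obtain ⟨e, he, rfl⟩ := hx
    rw [if_neg (fun h => hmain (entryCond_imp he h)), mul_zero]

end Summit.Parity.GeneralizedHardyLittlewood.FordMaynardSieveConst01651SieveConst01651

end
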